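import Literature.MathematicalPhysics.StatisticalMechanics.LennardJonesClusters
import HarnessLib

/-!
# Route EnergyDerivativeOrder · LimitTransfer — helper IV: the counting step

Support lemma for item stmt-AtomisticToContinuum-12284 (`LimitTransfer`): the deterministic
pigeonhole behind "pair statistics ⇒ a defect-free ball" (Blanc–Lewin 2015, §2.1, the step from
(ii') to (16) in the route's sketch), for ONE finite configuration `y : Fin N → ℝ³`, an abstract
predicate `ok` on pair distances ("within `η` of an allowed distance") and two test functions:

* a *forbidden-distance* function `Wf ≥ 0` which is `≥ 1` at every realised non-`ok` distance
  `≤ 2R` — so a particle taking part in a bad pair has site energy `≥ 1` ("marked"), marked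
  particles number `≤ 2·𝓔_{Wf}`, and particles whose `R`-ball contains a bad pair ("unclean")
  lie within `R` of a marked one;
* a *shell* function `0 ≤ Ws ≤ 1` vanishing beyond the shell radius `ρ` — so the site energy of
  `Ws` is at most the shell count `c_i = #{j ≠ i : dist ≤ ρ}`, whence `∑ c_i ≥ 2·𝓔_{Ws}`;
  with `c_i ≤ 12` for clean particles (the gapped kissing bound, an input here) the clean
  particles with `c_i ≠ 12` number `≤ K·#unclean + (12 N − 2·𝓔_{Ws})`.

If `C · ((K+1) · C · 2𝓔_{Wf} + (12N − 2𝓔_{Ws})) < N` (`C` a packing bound for `R`-balls, `K`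
for shells), some particle has only good particles — clean, with shell count exactly `12` — in
its `R`-ball (`exists_good_particle`). [folklore]
-/

noncomputable section

namespace Summit.AtomisticToContinuum.Crystallization.Theorems.EnergyDerivativeOrderLimitTransfer

open scoped BigOperators
open Finset Metric
open Literature.MathematicalPhysics.StatisticalMechanics

variable {N : ℕ}

/-- The site energy of a non-negative pair function is non-negative. [folklore] -/
theorem siteEnergy_nonneg {W : ℝ → ℝ} (hW : ∀ r, 0 ≤ W r) (y : Fin N → EuclideanSpace ℝ (Fin 3))
    (i : Fin N) : 0 ≤ siteEnergy W y i :=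
  Finset.sum_nonneg fun _ _ => hW _

/-- One term bounds the site energy of a non-negative pair function from below. [folklore] -/
theorem le_siteEnergy_of_ne {W : ℝ → ℝ} (hW : ∀ r, 0 ≤ W r) (y : Fin N → EuclideanSpace ℝ (Fin 3))
    {i l : Fin N} (hl : l ≠ i) : W (dist (y i) (y l)) ≤ siteEnergy W y i := by
  unfold siteEnergy
  exact Finset.single_le_sum (f := fun k => W (dist (y i) (y k))) (fun _ _ => hW _)
    (Finset.mem_erase.2 ⟨hl, Finset.mem_univ _⟩)

/-- **Marked particles are few**: the particles with site energy `≥ 1` of a non-negative pair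
function `W` number at most `2 · 𝓔_W`. [folklore] -/
theorem card_marked_le {W : ℝ → ℝ} (hW : ∀ r, 0 ≤ W r) (y : Fin N → EuclideanSpace ℝ (Fin 3)) :
    ((univ.filter fun j => 1 ≤ siteEnergy W y j).card : ℝ) ≤ 2 * interactionEnergy W y := by
  classical
  rw [two_mul_interactionEnergy, Finset.cast_card]
  calc ∑ _j ∈ univ.filter (fun j => 1 ≤ siteEnergy W y j), (1 : ℝ)
      ≤ ∑ j ∈ univ.filter (fun j => 1 ≤ siteEnergy W y j), siteEnergy W y j :=
        Finset.sum_le_sum fun j hj => (Finset.mem_filter.1 hj).2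
    _ ≤ ∑ j, siteEnergy W y j :=
        Finset.sum_le_sum_of_subset_of_nonneg (Finset.filter_subset _ _)
          fun j _ _ => siteEnergy_nonneg hW y j

/-- **The shell function sees at most the shell count**: if `0 ≤ W ≤ 1` and `W` vanishes beyond
`ρ`, the site energy of `W` at `i` is at most `#{j ≠ i : dist (y j) (y i) ≤ ρ}`. [folklore] -/
theorem siteEnergy_le_card_shell {W : ℝ → ℝ} {ρ : ℝ} (hW : ∀ r, 0 ≤ W r ∧ W r ≤ 1)
    (hWρ : ∀ r, W r ≠ 0 → r ≤ ρ) (y : Fin N → EuclideanSpace ℝ (Fin 3)) (i : Fin N) :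
    siteEnergy W y i ≤ ((univ.filter fun j => j ≠ i ∧ dist (y j) (y i) ≤ ρ).card : ℝ) := by
  classical
  unfold siteEnergy
  have hpt : ∀ k ∈ univ.erase i,
      W (dist (y i) (y k)) ≤ if dist (y k) (y i) ≤ ρ then (1 : ℝ) else 0 := by
    intro k _
    split_ifs with hk
    · exact (hW _).2
    · have : W (dist (y i) (y k)) = 0 := by
        by_contra hne
        exact hk (by rw [dist_comm]; exact hWρ _ hne)
      rw [this]
  refine (Finset.sum_le_sum hpt).trans ?_
  rw [Finset.sum_boole]
  have : (univ.erase i).filter (fun k => dist (y k) (y i) ≤ ρ) =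
      univ.filter fun j => j ≠ i ∧ dist (y j) (y i) ≤ ρ := by
    ext k
    simp [Finset.mem_erase, Finset.mem_filter]
  rw [this]

/-- **The counting step** (deterministic form, one configuration). See the module docstring.
[folklore] -/
theorem exists_good_particle (y : Fin N → EuclideanSpace ℝ (Fin 3)) (ok : ℝ → Prop)
    {R ρ K C : ℝ} {Wf Ws : ℝ → ℝ} (hN : 0 < N) (hR : 0 ≤ R) (hC0 : 0 ≤ C)
    (hK : ∀ i, ((univ.filter fun j => j ≠ i ∧ dist (y j) (y i) ≤ ρ).card : ℝ) ≤ K)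
    (hC : ∀ c : EuclideanSpace ℝ (Fin 3), ((univ.filter fun j => dist (y j) c ≤ R).card : ℝ) ≤ C)
    (hWf0 : ∀ r, 0 ≤ Wf r)
    (hWf1 : ∀ l l' : Fin N, l ≠ l' → dist (y l) (y l') ≤ 2 * R → ¬ ok (dist (y l) (y l')) →
      1 ≤ Wf (dist (y l) (y l')))
    (hWs : ∀ r, 0 ≤ Ws r ∧ Ws r ≤ 1) (hWsρ : ∀ r, Ws r ≠ 0 → r ≤ ρ)
    (h12 : ∀ i, (∀ l l', dist (y l) (y i) ≤ R → dist (y l') (y i) ≤ R → l ≠ l' →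
        ok (dist (y l) (y l'))) →
      (univ.filter fun j => j ≠ i ∧ dist (y j) (y i) ≤ ρ).card ≤ 12)
    (hstat : C * ((K + 1) * (C * (2 * interactionEnergy Wf y)) +
      (12 * N - 2 * interactionEnergy Ws y)) < N) :
    ∃ i : Fin N, (∀ l l', dist (y l) (y i) ≤ R → dist (y l') (y i) ≤ R → l ≠ l' →
        ok (dist (y l) (y l'))) ∧
      ∀ j, dist (y j) (y i) ≤ R →
        (univ.filter fun l => l ≠ j ∧ dist (y l) (y j) ≤ ρ).card = 12 := by
  classical
  -- vocabulary
  let clean : Fin N → Prop := fun i => ∀ l l', dist (y l) (y i) ≤ R → dist (y l') (y i) ≤ R →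
    l ≠ l' → ok (dist (y l) (y l'))
  let c : Fin N → ℕ := fun i => (univ.filter fun j => j ≠ i ∧ dist (y j) (y i) ≤ ρ).card
  let good : Fin N → Prop := fun i => clean i ∧ c i = 12
  let marked : Finset (Fin N) := univ.filter fun j => 1 ≤ siteEnergy Wf y j
  let unclean : Finset (Fin N) := univ.filter fun i => ¬ clean i
  let offshell : Finset (Fin N) := univ.filter fun i => clean i ∧ c i ≠ 12
  let bad : Finset (Fin N) := univ.filter fun i => ¬ good i
  let spoiled : Finset (Fin N) := univ.filter fun i => ∃ j, dist (y j) (y i) ≤ R ∧ ¬ good j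
  -- (1) marked particles are few
  have hmarked : (marked.card : ℝ) ≤ 2 * interactionEnergy Wf y := card_marked_le hWf0 y
  -- (2) unclean particles lie within `R` of a marked one
  have hunclean_sub : unclean ⊆ marked.biUnion fun l => univ.filter fun i => dist (y i) (y l) ≤ R := by
    intro i hi
    have hi' : ¬ clean i := (Finset.mem_filter.1 hi).2
    simp only [clean, not_forall, exists_prop] at hi'
    obtain ⟨l, l', hl, hl', hll', hbad⟩ := hi'
    have h2R : dist (y l) (y l') ≤ 2 * R := by
      have := dist_triangle (y l) (y i) (y l')
      rw [dist_comm (y i) (y l')] at this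
      linarith
    have hW1 : 1 ≤ Wf (dist (y l) (y l')) := hWf1 l l' hll' h2R hbad
    have hml : l ∈ marked := by
      refine Finset.mem_filter.2 ⟨Finset.mem_univ _, ?_⟩
      exact hW1.trans (le_siteEnergy_of_ne hWf0 y (Ne.symm hll'))
    exact Finset.mem_biUnion.2 ⟨l, hml, Finset.mem_filter.2 ⟨Finset.mem_univ _, by rwa [dist_comm]⟩⟩
  have hunclean : (unclean.card : ℝ) ≤ C * (2 * interactionEnergy Wf y) := by
    calc (unclean.card : ℝ)
        ≤ ((marked.biUnion fun l => univ.filter fun i => dist (y i) (y l) ≤ R).card : ℝ) := by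
          exact_mod_cast Finset.card_le_card hunclean_sub
      _ ≤ ∑ l ∈ marked, ((univ.filter fun i => dist (y i) (y l) ≤ R).card : ℝ) := by
          exact_mod_cast Finset.card_biUnion_le
      _ ≤ ∑ _l ∈ marked, C := Finset.sum_le_sum fun l _ => hC (y l)
      _ = marked.card * C := by rw [Finset.sum_const, nsmul_eq_mul]
      _ ≤ 2 * interactionEnergy Wf y * C := by gcongr
      _ = C * (2 * interactionEnergy Wf y) := by ring
  -- (3) the shell counts dominate the shell energy
  have hshell_sum : 2 * interactionEnergy Ws y ≤ ∑ i, (c i : ℝ) := by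
    rw [two_mul_interactionEnergy]
    exact Finset.sum_le_sum fun i _ => siteEnergy_le_card_shell hWs hWsρ y i
  -- (4) clean particles off the exact shell count are few
  have hsplit : ∑ i, (c i : ℝ) = ∑ i ∈ unclean, (c i : ℝ) + ∑ i ∈ univ.filter clean, (c i : ℝ) := by
    rw [add_comm]
    exact (Finset.sum_filter_add_sum_filter_not univ clean fun i => (c i : ℝ)).symm
  have hsum_unclean : ∑ i ∈ unclean, (c i : ℝ) ≤ K * unclean.card := by
    calc ∑ i ∈ unclean, (c i : ℝ) ≤ ∑ _i ∈ unclean, K := Finset.sum_le_sum fun i _ => hK i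
      _ = K * unclean.card := by rw [Finset.sum_const, nsmul_eq_mul, mul_comm]
  have hsum_clean : ∑ i ∈ univ.filter clean, (c i : ℝ) ≤
      12 * (univ.filter clean).card - offshell.card := by
    have hpt : ∀ i ∈ univ.filter clean,
        (c i : ℝ) ≤ 12 - if clean i ∧ c i ≠ 12 then (1 : ℝ) else 0 := by
      intro i hi
      have hci : clean i := (Finset.mem_filter.1 hi).2
      have hle : c i ≤ 12 := h12 i hci
      split_ifs with hc
      · have : c i ≤ 11 := by have := hc.2; omega
        have : (c i : ℝ) ≤ 11 := by exact_mod_cast this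
        linarith
      · have : (c i : ℝ) ≤ 12 := by exact_mod_cast hle
        linarith
    refine (Finset.sum_le_sum hpt).trans ?_
    rw [Finset.sum_sub_distrib, Finset.sum_const, nsmul_eq_mul, Finset.sum_boole]
    have : (univ.filter clean).filter (fun i => clean i ∧ c i ≠ 12) = offshell := by
      ext i
      simp [offshell]
    rw [this]
    linarith
  have hoffshell : (offshell.card : ℝ) ≤ K * unclean.card + (12 * N - 2 * interactionEnergy Ws y) := by
    have hcleanN : ((univ.filter clean).card : ℝ) ≤ N := by
      have := Finset.card_le_card (Finset.filter_subset clean (univ : Finset (Fin N)))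
      rw [Finset.card_univ, Fintype.card_fin] at this
      exact_mod_cast this
    linarith
  -- (5) bad particles are few
  have hbad_sub : bad ⊆ unclean ∪ offshell := by
    intro i hi
    have hi' : ¬ good i := (Finset.mem_filter.1 hi).2
    by_cases hci : clean i
    · refine Finset.mem_union_right _ (Finset.mem_filter.2 ⟨Finset.mem_univ _, hci, ?_⟩)
      exact fun h => hi' ⟨hci, h⟩
    · exact Finset.mem_union_left _ (Finset.mem_filter.2 ⟨Finset.mem_univ _, hci⟩)
  have hbad : (bad.card : ℝ) ≤ (K + 1) * (C * (2 * interactionEnergy Wf y)) +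
      (12 * N - 2 * interactionEnergy Ws y) := by
    have h1 : (bad.card : ℝ) ≤ unclean.card + offshell.card := by
      have := (Finset.card_le_card hbad_sub).trans (Finset.card_union_le _ _)
      exact_mod_cast this
    have hK0 : 0 ≤ K := by
      obtain ⟨i⟩ : Nonempty (Fin N) := ⟨⟨0, hN⟩⟩
      exact le_trans (Nat.cast_nonneg _) (hK i)
    nlinarith
  -- (6) spoiled particles are few, so some particle is unspoiled
  have hspoiled_sub : spoiled ⊆ bad.biUnion fun j => univ.filter fun i => dist (y i) (y j) ≤ R := by
    intro i hi
    obtain ⟨j, hj, hjbad⟩ := (Finset.mem_filter.1 hi).2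
    exact Finset.mem_biUnion.2 ⟨j, Finset.mem_filter.2 ⟨Finset.mem_univ _, hjbad⟩,
      Finset.mem_filter.2 ⟨Finset.mem_univ _, by rwa [dist_comm]⟩⟩
  have hspoiled : (spoiled.card : ℝ) < N := by
    calc (spoiled.card : ℝ)
        ≤ ((bad.biUnion fun j => univ.filter fun i => dist (y i) (y j) ≤ R).card : ℝ) := by
          exact_mod_cast Finset.card_le_card hspoiled_sub
      _ ≤ ∑ j ∈ bad, ((univ.filter fun i => dist (y i) (y j) ≤ R).card : ℝ) := by
          exact_mod_cast Finset.card_biUnion_le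
      _ ≤ ∑ _j ∈ bad, C := Finset.sum_le_sum fun j _ => hC (y j)
      _ = C * bad.card := by rw [Finset.sum_const, nsmul_eq_mul, mul_comm]
      _ ≤ C * ((K + 1) * (C * (2 * interactionEnergy Wf y)) +
            (12 * N - 2 * interactionEnergy Ws y)) := by gcongr
      _ < N := hstat
  have hex : ∃ i, i ∉ spoiled := by
    by_contra hall
    push Not at hall
    have : spoiled = univ := Finset.eq_univ_of_forall hall
    rw [this, Finset.card_univ, Fintype.card_fin] at hspoiled
    exact lt_irrefl _ hspoiled
  obtain ⟨i, hi⟩ := hex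
  have hgood : ∀ j, dist (y j) (y i) ≤ R → good j := by
    intro j hj
    by_contra hjbad
    exact hi (Finset.mem_filter.2 ⟨Finset.mem_univ _, j, hj, hjbad⟩)
  have hii : good i := hgood i (by rw [dist_self]; exact hR)
  exact ⟨i, hii.1, fun j hj => (hgood j hj).2⟩

end Summit.AtomisticToContinuum.Crystallization.Theorems.EnergyDerivativeOrderLimitTransfer

end
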